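import Mathlib
import Summits.KontsevichZagierPeriods.Zeta5Search.LongClassDecide52
import HarnessLib

/-!
# ζ(5) search — long classes of the record ray II-A: the finite frame check for `M = 52`, parts `(c₀, u) = (0, 0), (0, 1)`

Cell `pub-zeta5` (HONEST FRAMING: systematic search; no irrationality claim unless certified), typer seat generation 13.
Kernel evaluation (`decide +kernel`) of `LongClass.check52Part` (file `LongClassDecide52`) for `c₀ = 0`, `u ∈ {0, 1}`
(`L = 38, 39`); about a minute of kernel time each.  Pure finite combinatorics; nothing here bears on irrationality.
-/

namespace Summit.KontsevichZagierPeriods.Zeta5Search.LongClass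

set_option maxHeartbeats 1600000 in
/-- The finite check, part `(0, 0)`. -/
theorem check52_00 : check52Part 0 0 = true := by decide +kernel

set_option maxHeartbeats 1600000 in
/-- The finite check, part `(0, 1)`. -/
theorem check52_01 : check52Part 0 1 = true := by decide +kernel

end Summit.KontsevichZagierPeriods.Zeta5Search.LongClass
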